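import Summits.HubbardSuperconductivity.HubbardSuperconductivity.Theses.NodalDiracTwist
import Summits.HubbardSuperconductivity.HubbardSuperconductivity.Theorems.NodalDiracTwistDiskTrivialHolonomyCore
import Summits.HubbardSuperconductivity.HubbardSuperconductivity.Theorems.NodalDiracTwistRealCyclicOverlap

/-!
# Route `NodalDiracTwist` — support `DiskTrivialHolonomy`

`DiskTrivialHolonomy` (stmt-HubbardSuperconductivity-1627): for the spin-twisted Hubbard torus
`H_L(U, φ)` inlined in the route's items (by `rfl` the tree's `spinTwistedHubbardTorus L U φ`,
`spinTwistedHubbardTorus_eq_inline`), if the `(N, S^z = 0)`-sector ground state is unique up to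
scalars on the closed disk `|φ - p| ≤ r`, then for all sufficiently fine discretisations of the
boundary circle and all unit ground-state choices `ψ_i` the cyclic overlap product
`∏ ⟨ψ_i, ψ_{i+1}⟩` has positive real part (trivial `ℤ₂` holonomy; contrapositively `Re ∏ < 0`
certifies an enclosed degeneracy).

This file supplies the model-specific inputs of the abstract theorem `re_prod_cyclicOverlap_pos`
(`NodalDiracTwistDiskTrivialHolonomyCore`): continuity of `φ ↦ H_L(U, φ)`; the ANTIUNITARY
SYMMETRY `T = K ∘ F` — `K` entrywise conjugation (`spinTwistedHubbardTorus_map_star`, tree) and `F`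
the spin-exchange unitary `fockRelabel Orb.spinSwap`, with `F H_L(U,φ) F⁻¹ = H_L(U,-φ)`,
`F S^z F⁻¹ = -S^z`, sector preservation and unitarity taken from
`NodalDiracTwistRealCyclicOverlap` (the `RealCyclicOverlap` item of the same route) — in the
matrix–vector form `F conj(H v) = H (F conj v)`; and the description of `szSector N 0` as a
coordinate sector, so that the tree's `sector_groundState` gives existence of
sector ground states and the variational bound (an empty sector has no ground states and the
claim is vacuous). Sources: Y. Hatsugai, J. Phys. Soc. Jpn. 75 (2006) 123601 (quantised Berry
phases from an antiunitary symmetry); T. Fukui, Y. Hatsugai, H. Suzuki, J. Phys. Soc. Jpn. 74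
(2005) 1674 (lattice link variables); E. H. Lieb, PRL 62 (1989) 1201 (the model, `S^z`
sectors). No new definitions.
-/

-- the mandated namespace `Summit.<Summit>.<Problem>.Theorems` repeats `HubbardSuperconductivity`
-- (single-problem summit, D-0017), which the `dupNamespace` linter flags on every declaration
set_option linter.dupNamespace false

namespace Summit.HubbardSuperconductivity.HubbardSuperconductivity.Theorems.NodalDiracTwist

open Matrix Complex Literature.MathematicalPhysics.QuantumLattice HubbardWave0
open scoped ComplexOrder

/-! ### The sector `(N, S^z = 0)` as a coordinate sector -/

section Sector

variable {Λ : Type*} [LinearOrder Λ] [Fintype Λ]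

/-- The joint sector `(N, S^z = 0)` is the coordinate subspace of the occupation basis spanned by
the configurations with `N` electrons, as many up as down. Lieb, PRL 62 (1989) 1201 ("the
`S^z = 0` subspace"). [folklore] -/
theorem mem_szSector_zero_iff_coord (N : ℕ) (v : Fock (Orb Λ)) :
    v ∈ szSector N 0 ↔
      ∀ s, ¬ (s.card = N ∧ (upPart s).card = (downPart s).card) → v s = 0 := by
  rw [mem_szSector_iff]
  constructor
  · rintro ⟨hN, hZ⟩ s hs
    by_cases hcard : s.card = N
    · have h := congrFun hZ s
      rw [LiebThm1.spinZ_mulVec_apply, Pi.smul_apply, smul_eq_mul, Complex.ofReal_zero,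
        zero_mul] at h
      rcases mul_eq_zero.1 h with h1 | h1
      · rcases mul_eq_zero.1 h1 with h2 | h2
        · norm_num at h2
        · exact absurd ⟨hcard, by exact_mod_cast sub_eq_zero.1 h2⟩ hs
      · exact h1
    · exact hN s hcard
  · intro h
    refine ⟨fun s hs => h s fun h' => hs h'.1, ?_⟩
    funext s
    rw [LiebThm1.spinZ_mulVec_apply, Pi.smul_apply, smul_eq_mul, Complex.ofReal_zero, zero_mul]
    by_cases hs : s.card = N ∧ (upPart s).card = (downPart s).card
    · rw [hs.2, sub_self, mul_zero, zero_mul]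
    · rw [h s hs, mul_zero]

end Sector

/-! ### The spin-twisted torus: continuity, the antiunitary symmetry, the closing theorem -/

section Twisted

variable (L : ℕ) [NeZero L]

/-- `φ ↦ H_L(U, φ)` is continuous (finite sums of `e^{±iθ(φ)}` times fixed matrices). [folklore] -/
theorem continuous_spinTwistedHubbardTorus (U : ℝ) :
    Continuous fun φ : Fin 2 → ℝ => spinTwistedHubbardTorus L U φ := by
  unfold spinTwistedHubbardTorus spinTwistedHopping
  refine Continuous.add (Continuous.neg ?_) continuous_const
  refine continuous_finsetSum _ fun x _ => continuous_finsetSum _ fun μ _ =>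
    continuous_finsetSum _ fun σ _ => ?_
  have hθ : Continuous fun φ : Fin 2 → ℝ => (((-1 : ℝ) ^ (σ : ℕ) * φ μ / L : ℝ) : ℂ) :=
    Complex.continuous_ofReal.comp (((continuous_apply μ).const_mul _).div_const _)
  exact ((Complex.continuous_exp.comp (hθ.const_mul _)).smul continuous_const).add
    ((Complex.continuous_exp.comp (hθ.const_mul _).neg).smul continuous_const)

/-- `H_L(U, φ)` has no matrix entries between the coordinate sector of `szSector N 0` and its
complement (it conserves `N↑`, `N↓`). Lieb, PRL 62 (1989) 1201, Remark (2)(i). [folklore] -/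
theorem spinTwistedHubbardTorus_apply_eq_zero (U : ℝ) (φ : Fin 2 → ℝ) (N : ℕ)
    (s s' : Finset (Orb (FermionTorus 2 L)))
    (hs : ¬ (s.card = N ∧ (upPart s).card = (downPart s).card))
    (hs' : s'.card = N ∧ (upPart s').card = (downPart s').card) :
    spinTwistedHubbardTorus L U φ s s' = 0 := by
  by_contra h
  have hP := preservesSectors_spinTwistedHubbardTorus L U φ s s' h
  apply hs
  refine ⟨?_, hP.1.trans (hs'.2.trans hP.2.symm)⟩
  rw [card_eq_upPart_add_downPart, hP.1, hP.2, ← card_eq_upPart_add_downPart, hs'.1]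

/-- **The antiunitary symmetry `T = K ∘ F` of the spin-twisted torus**, in matrix–vector form:
`F conj(H_L(U,φ) v) = H_L(U,φ) (F conj v)` for the spin-exchange unitary `F` (`K` reverses the
twist by `spinTwistedHubbardTorus_map_star`, `F` reverses it back). Hatsugai, J. Phys. Soc. Jpn.
75 (2006) 123601. [folklore] -/
theorem fockRelabel_spinSwap_mulVec_star_mulVec (U : ℝ) (φ : Fin 2 → ℝ)
    (v : Fock (Orb (FermionTorus 2 L))) :
    (fockRelabel (Orb.spinSwap : Orb (FermionTorus 2 L) ≃ Orb (FermionTorus 2 L))).val *ᵥ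
        star (spinTwistedHubbardTorus L U φ *ᵥ v) =
      spinTwistedHubbardTorus L U φ *ᵥ
        ((fockRelabel (Orb.spinSwap : Orb (FermionTorus 2 L) ≃ Orb (FermionTorus 2 L))).val *ᵥ
          star v) := by
  have hconj : (fockRelabel (Orb.spinSwap : Orb (FermionTorus 2 L) ≃ Orb (FermionTorus 2 L))).val *
      spinTwistedHubbardTorus L U (-φ) *
      (fockRelabel (Orb.spinSwap : Orb (FermionTorus 2 L) ≃ Orb (FermionTorus 2 L))).valᴴ =
      spinTwistedHubbardTorus L U φ := by
    rw [← relabel_eq_fockRelabel_conj, relabel_spinSwap_spinTwistedHubbardTorus, neg_neg]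
  have hF := fockRelabel_mul_eq_of_conj_eq _ hconj
  rw [star_mulVec_eq_map_star_mulVec, spinTwistedHubbardTorus_map_star, mulVec_mulVec, hF,
    ← mulVec_mulVec]

/-- **`DiskTrivialHolonomy` for the tree's `spinTwistedHubbardTorus`** (the route's inlined
`H_L(U, φ)` by `spinTwistedHubbardTorus_eq_inline`): if the `(N, S^z = 0)`-sector ground state
of `H_L(U, φ)` is unique up to scalars on the closed disk `|φ - p| ≤ r`, then for all fine
discretisations of the boundary circle and all unit ground-state choices the cyclic overlap
product has positive real part. The abstract `re_prod_cyclicOverlap_pos` with `K = szSector N 0`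
(a coordinate sector, so `sector_groundState` supplies existence and the variational bound; if
the sector is empty there are no ground states and the claim is vacuous) and the antiunitary
`T v = F v̄`, `F` the spin-exchange unitary. Hatsugai, J. Phys. Soc. Jpn. 75 (2006) 123601;
Fukui–Hatsugai–Suzuki, J. Phys. Soc. Jpn. 74 (2005) 1674. [folklore] -/
theorem diskTrivialHolonomy_twisted (U : ℝ) (N : ℕ) (p : Fin 2 → ℝ) (r : ℝ) (hr : 0 < r)
    (huniq : ∀ φ : Fin 2 → ℝ, (φ 0 - p 0) ^ 2 + (φ 1 - p 1) ^ 2 ≤ r ^ 2 →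
      ∀ χ₁ χ₂ : Fock (Orb (FermionTorus 2 L)),
      IsGroundStateInSector (spinTwistedHubbardTorus L U φ) N 0 χ₁ →
      IsGroundStateInSector (spinTwistedHubbardTorus L U φ) N 0 χ₂ → ∃ z : ℂ, χ₂ = z • χ₁) :
    ∃ n₀ : ℕ, ∀ n ≥ n₀, ∀ ψ : Fin n → Fock (Orb (FermionTorus 2 L)),
      (∀ i : Fin n, IsGroundStateInSector (spinTwistedHubbardTorus L U (fun ν : Fin 2 => p ν + r *
        (if ν = 0 then Real.cos (2 * Real.pi * (i : ℕ) / n)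
          else Real.sin (2 * Real.pi * (i : ℕ) / n)))) N 0 (ψ i) ∧ star (ψ i) ⬝ᵥ ψ i = 1) →
      0 < (∏ i : Fin n, star (ψ i) ⬝ᵥ ψ (finRotate n i)).re := by
  classical
  by_cases hp : ∃ s : Finset (Orb (FermionTorus 2 L)),
      s.card = N ∧ (upPart s).card = (downPart s).card
  · have hsg := fun φ : Fin 2 → ℝ => sector_groundState (spinTwistedHubbardTorus L U φ)
      (spinTwistedHubbardTorus_isHermitian L U φ)
      (fun s : Finset (Orb (FermionTorus 2 L)) => s.card = N ∧ (upPart s).card = (downPart s).card)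
      hp (fun s s' hs hs' => spinTwistedHubbardTorus_apply_eq_zero L U φ N s s' hs hs')
      (szSector N 0) (mem_szSector_zero_iff_coord N)
    set F := (fockRelabel (Orb.spinSwap : Orb (FermionTorus 2 L) ≃ Orb (FermionTorus 2 L))).val
      with hF
    have hTs : ∀ (c : ℂ) (v : Fock (Orb (FermionTorus 2 L))),
        F *ᵥ star (c • v) = star c • (F *ᵥ star v) := fun c v => by
      rw [star_smul, mulVec_smul]
    have hTK : ∀ v ∈ szSector N (0 : ℝ), F *ᵥ star v ∈ szSector N (0 : ℝ) := fun v hv =>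
      fockRelabel_spinSwap_mulVec_mem_szSector
        (Summit.HubbardSuperconductivity.HubbardSuperconductivity.Theorems.NodalDiracTwist.star_mem_szSector
          hv)
    have hTH : ∀ (φ : Fin 2 → ℝ) (v : Fock (Orb (FermionTorus 2 L))),
        F *ᵥ star (spinTwistedHubbardTorus L U φ *ᵥ v) =
          spinTwistedHubbardTorus L U φ *ᵥ (F *ᵥ star v) := fun φ v =>
      fockRelabel_spinSwap_mulVec_star_mulVec L U φ v
    have hTd : ∀ u v : Fock (Orb (FermionTorus 2 L)),
        star (F *ᵥ star u) ⬝ᵥ (F *ᵥ star v) = star (star u ⬝ᵥ v) := fun u v => by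
      rw [hF, star_fockRelabel_mulVec_dotProduct_fockRelabel_mulVec, star_star, dotProduct_star,
        dotProduct_comm]
    have key := re_prod_cyclicOverlap_pos (szSector N 0) (spinTwistedHubbardTorus L U)
      (continuous_spinTwistedHubbardTorus L U) (fun φ => (hsg φ).2) (fun φ => (hsg φ).1)
      (fun φ χ => IsGroundStateInSector (spinTwistedHubbardTorus L U φ) N 0 χ)
      (fun _ _ => Iff.rfl) (fun v => F *ᵥ star v) hTs hTK hTH hTd p hr huniq
    exact key
  · -- the sector is empty: there are no ground states at all
    push Not at hp
    refine ⟨1, fun n hn ψ hψ => ?_⟩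
    obtain ⟨hmem, hne, -⟩ := (hψ ⟨0, by omega⟩).1
    exact (hne (funext fun s =>
      (mem_szSector_zero_iff_coord N _).1 hmem s fun h => hp s h.1 h.2)).elim

/-- **`DiskTrivialHolonomy`** (stmt-HubbardSuperconductivity-1627, route NodalDiracTwist): the
instrument lemma of the route — uniqueness of the `(N, 0)`-sector ground state of `H_L(U, φ)` on
a closed disk forces trivial (`+1`) holonomy of the (real) ground-state bundle around its
boundary, read through the cyclic overlap product of arbitrary unit ground states on every fine
discretisation of the boundary circle; contrapositively a loop with `Re ∏ < 0` encloses a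
degeneracy. The route's inlined `let H` is the tree's `spinTwistedHubbardTorus L U` by `rfl`.
Hatsugai, J. Phys. Soc. Jpn. 75 (2006) 123601; Fukui–Hatsugai–Suzuki, J. Phys. Soc. Jpn. 74
(2005) 1674; Kato (1966) II §5.1. [folklore] -/
theorem diskTrivialHolonomy_proof :
    Summit.HubbardSuperconductivity.HubbardSuperconductivity.Theses.NodalDiracTwist.DiskTrivialHolonomy :=
  fun L _ U N p r hr => diskTrivialHolonomy_twisted L U N p r hr

end Twisted

end Summit.HubbardSuperconductivity.HubbardSuperconductivity.Theorems.NodalDiracTwist
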